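import Literature.NumberTheory.GaloisCohomology.Howard2004.FrobeniusReadoutLagrangianTransferProofs
import Literature.NumberTheory.GaloisCohomology.Howard2004.LocalTwoDetectsFiniteProofs
import Literature.NumberTheory.GaloisCohomology.Howard2004.DVRSettingEngineLocalInputsProofs
import Literature.NumberTheory.GaloisCohomology.Howard2004.DVRSettingEngineEpsilonProofs
import Literature.NumberTheory.GaloisCohomology.Howard2004.SelfOrthogonalOfIsotropicCountProofs
import Literature.NumberTheory.GaloisCohomology.Howard2004.TransverseScalarStableProofs
import Literature.NumberTheory.GaloisRepresentations.CompatibleRootsOfUnityLogProofs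
import Literature.NumberTheory.GaloisRepresentations.ContinuousH2OrderTwo
import Literature.Algebra.Module.QuotientDVRSocleCyclicProofs
import HarnessLib

/-!
# Howard 2004, Lemma 1.6.4 on a `DVRSetting`: the ENGINE binder `h159` (Prop. 1.5.9
# «`loc_q(Stub^{(k)}(n)) = 0 ⟹ loc_q(Stub^{(k)}(nq)) = 0`») in the engine's own currency — proofs file

Topic `NumberTheory/GaloisCohomology/Howard2004`.  THEOREMS ONLY: no definition, no named fact, no instance, no
notation, no `sorry`.  B. Howard, *The Heegner point Kolyvagin system*, Compositio Math. **140** (2004) =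
arXiv:1202.6340: Lemma 1.6.4 (arXiv Lemma 2.6.4, p. 11 L82 – p. 12 L27) is the double induction proving
`κ^{(k)}_n ∈ Stub^{(k)}(n)`; the cell's ENGINE (`StubLemmaInductionProofs`, `DVRSettingEngineData`) consumes Prop. 1.5.9
(arXiv Prop. 2.5.9, p. 10 L146 – p. 11 L13) as the binder
`h159 : ∀ k n ℓ, ↑n ⊆ P k → ℓ ∈ P k → ℓ ∉ n → Stub k n ≤ ker (loc k n ℓ) → Stub k (insert ℓ n) ≤ ker (loc k (insert ℓ n) ℓ)`.
THIS FILE delivers it VERBATIM on a `DVRSetting` `S` with H.0–H.5 (`P k := S.enginePrimes k`,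
`H k n := ↥(S.selmerModuleAt hy k n)`, `loc := S.locR` restricted, `Stub := S.stub hy hdec`) by instantiating the
Frobenius-form Prop. 1.5.9 at an inert Kolyvagin prime (`smul_le_ker_of_smul_le_ker_of_inert_local_frob`) at the level
ring `R_k = R/𝔪^{e_k}` and DISCHARGING its binders from the tree: the Frobenius character of `R_k`, `Θ` bijective,
`H²`-detection (finite places: `eq_zero_of_forall_cohomologyMap_expLam_eq_zero_of_finite`; infinite: odd torsion),
`exp = log⁻¹` (`exists_compatible_muLog`), the socle letter, the Poitou–Tate family at `p^{e_k}` (from the named fact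
`poitouTate_selmerStructure_duality K`, a HYPOTHESIS `hPT`), the local arithmetic at the primes of `nλ`
(`DVRSettingEngineLocalInputsProofs`: `σλ = λ`, trivial actions, Prop. 1.1.9 `R`-linearly with `d_K < -4`, counts,
`hcyc`, `𝓕_λ = H¹_ur`, no archimedean term), H.4 for `𝓕(n)` (`hy.h4` off `n`, `isSelfOrthogonalAt_of_transverse` on
`n`), scalar stability, the two structure decompositions of `hdec` (`λ = stubLength`) and Prop. 1.5.5 (the same `ε`,
`epsilon_eq_of_linearEquiv_decompositions`).  NOT discharged (level-uniform binders): `hpar` («`ρ(n) mod 2` independent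
of `n`», Lemma 1.5.3, torsion currency); the conjugation-DATUM letters `hI`, `hφ` (`φ_λ` respects inertia / the
ring-class subgroup; `hφ := ConjugationDatum.φ_mem_localRingClassSubgroup`), `hφI`, `hφΛ` (`φ_λ g ≡ g` mod inertia,
`≡ g⁻¹` mod `Γ_{K[ℓ]}`), `hδ` (symmetry of `e(·, δ_λ ·)`) — for a general `ConjugationDatum` these encode
«decomposition groups are self-normalising» (NSW (12.1.3)); `hPT`; `hd : d_K < -4`.
Cell `pub/bsd-print-x9`, print leaf G87 `thm161_dvrKolyvaginBound` (stub `stub_h161` of stmt-BirchSwinnertonDyer-22642);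
seat `bsd-line-x9-p1-w4` g17, brick (ENGINE-h159).  `thm161_dvrKolyvaginBound` is NOT proved here; no summit statement
is proved; the Birch–Swinnerton-Dyer conjecture is not proved by any of this.
References: [Howard2004HeegnerKolyvagin] Prop. 1.5.9, Lemma 1.6.4, Prop. 1.1.9, §1.3 H.4, Def. 1.5.4;
[MilneADT2006] I Cor. 2.3, Thm. 4.10; [Wood1999DualityCodesFiniteRings] Thm. 3.10.
-/

set_option autoImplicit false

noncomputable section

open CategoryTheory Function NumberField IsDedekindDomain Field
open scoped NumberField Classical

namespace Literature.NumberTheory.GaloisCohomology.Howard2004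

open Literature.NumberTheory.GaloisRepresentations
open Literature.NumberTheory.GaloisRepresentations.DiscreteGaloisModule
open Literature.RingTheory.CompleteLocalRings

/-! ## §0 Module-theoretic bookkeeping -/

section Algebra

open Pointwise
/-- Stub form ↔ transfer form: for an `R`-submodule `S₁ ≤ V`, a linear `f : V → W` and `a : R`,
`(a) • ⊤ ≤ ker (f|_{S₁})` in `↥S₁` iff `a • S₁ ≤ ker f` in `V`.
[cite: Howard2004HeegnerKolyvagin, Def. 1.5.4 (arXiv:1202.6340 p. 10 L56–60: `Stub(n) = 𝔪^{λ(n)} 𝓗(n)`)] -/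
theorem ideal_span_singleton_smul_top_le_ker_domRestrict_iff {R V W : Type*} [CommRing R] [AddCommGroup V]
    [Module R V] [AddCommGroup W] [Module R W] (f : V →ₗ[R] W) (S₁ : Submodule R V) (a : R) :
    (Ideal.span {a} • (⊤ : Submodule R ↥S₁)) ≤ LinearMap.ker (f.domRestrict S₁) ↔
      a • S₁ ≤ LinearMap.ker f := by
  rw [Submodule.ideal_span_singleton_smul]
  refine ⟨fun h x hx => ?_, fun h x hx => ?_⟩ <;> rw [Submodule.mem_smul_pointwise_iff_exists] at hx
  · obtain ⟨y, hy, rfl⟩ := hx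
    have := h (Submodule.smul_mem_pointwise_smul _ a ⊤ (Submodule.mem_top : (⟨y, hy⟩ : ↥S₁) ∈ ⊤))
    rw [LinearMap.mem_ker, LinearMap.domRestrict_apply] at this
    exact this
  · obtain ⟨y, -, rfl⟩ := hx
    have := h (Submodule.smul_mem_pointwise_smul _ a S₁ y.2)
    rw [LinearMap.mem_ker] at this
    rw [LinearMap.mem_ker, LinearMap.domRestrict_apply]
    exact this

/-- The length of a module with finitely many elements is finite. [folklore] -/
private theorem moduleLength_ne_top_of_finite {R M : Type*} [Ring R] [AddCommGroup M] [Module R M] [Finite M] :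
    Module.length R M ≠ ⊤ := by
  haveI : IsArtinian R M := isArtinian_of_finite
  exact Module.length_ne_top

end Algebra

/-! ## §1 The engine binder `h159` on a `DVRSetting` -/

namespace DVRSetting

variable {p : ℕ} [Fact p.Prime] {K : Type} [Field K] [NumberField K]
  {R : Type} [CommRing R] [IsDomain R] [IsDiscreteValuationRing R] [Algebra ℤ_[p] R]
  {N : ℕ → Type} [∀ k, AddCommGroup (N k)] [∀ k, TopologicalSpace (N k)]
  [∀ k, DiscreteTopology (N k)] [∀ k, Module R (N k)]
  {Rk : ℕ → Type} [∀ k, CommRing (Rk k)] [∀ k, IsLocalRing (Rk k)] [∀ k, TopologicalSpace (Rk k)]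
  [∀ k, DiscreteTopology (Rk k)] [∀ k, Algebra ℤ_[p] (Rk k)] [∀ k, Algebra R (Rk k)]
  [∀ k, Module (Rk k) (N k)] [∀ k, IsScalarTower R (Rk k) (N k)]
  {Nbar : Type} [AddCommGroup Nbar] [TopologicalSpace Nbar] [DiscreteTopology Nbar]
  [∀ k, Module (Rk k) Nbar]
  {Nq : ℕ → Finset (HeightOneSpectrum (𝓞 K)) → Type} [∀ k n, AddCommGroup (Nq k n)]
  [∀ k n, TopologicalSpace (Nq k n)] [∀ k n, DiscreteTopology (Nq k n)]
  [∀ k n, Module (Rk k) (Nq k n)] [∀ k n, Module R (Nq k n)]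
  [∀ k n, IsScalarTower R (Rk k) (Nq k n)]

/-- **`2 ∈ R^×`** on a `DVRSetting` with H (`p` odd, residue characteristic `p`).
[cite: Howard2004HeegnerKolyvagin, §1 conventions (arXiv:1202.6340 p. 4 L47–52), journal §1 (`p` odd)] -/
private theorem isUnit_two_of_satisfiesH (S : DVRSetting p K R N Rk Nbar Nq) (hy : S.SatisfiesH) : IsUnit (2 : R) := by
  by_contra h
  have hmem : (2 : R) ∈ IsLocalRing.maximalIdeal R :=
    (IsLocalRing.mem_maximalIdeal _).mpr (mem_nonunits_iff.mpr h)
  have hp : p.Prime := Fact.out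
  have hpmem : ((p : ℕ) : R) ∈ IsLocalRing.maximalIdeal R := S.natCast_p_mem_maximalIdeal hy
  have hcop : Nat.Coprime 2 p := (Nat.coprime_primes Nat.prime_two hp).mpr (Ne.symm hy.p_odd)
  obtain ⟨a, b, hab⟩ : IsCoprime (2 : ℤ) (p : ℤ) := Nat.isCoprime_iff_coprime.mpr hcop
  have h1 : (1 : R) ∈ IsLocalRing.maximalIdeal R := by
    have : ((a * 2 + b * p : ℤ) : R) = 1 := by rw [hab]; simp
    rw [← this]
    push_cast
    exact Ideal.add_mem _ (Ideal.mul_mem_left _ _ hmem) (Ideal.mul_mem_left _ _ hpmem)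
  exact (IsLocalRing.maximalIdeal.isMaximal R).ne_top ((Ideal.eq_top_iff_one _).mpr h1)

/-- **The ENGINE binder `h159` on a `DVRSetting` — Howard's Prop. 1.5.9 «`loc_λ(Stub^{(k)}(n)) = 0 ⟹
loc_λ(Stub^{(k)}(nλ)) = 0`» in the currency of `StubLemmaInductionProofs.mem_stub_of_stubLemmaInduction_levels'`**
(`P k = S.enginePrimes k`, `H k n = H¹_{F(n)}(K, T^{(k)}) = ↥(S.selmerModuleAt hy k n)`, `loc = S.locR` restricted,
`Stub = S.stub hy hdec`), at every level `k`, every `n ∈ 𝓝(𝓛^{(2k-1)})` and every `λ ∈ 𝓛^{(2k-1)} ∖ n`, with the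
datum letter `hδ` (symmetry of `e(·, δ_λ ·)` on `T^{(k)}`) asked ONLY at the engine primes `λ ∈ 𝓛^{(2k-1)}` of the level
— where `Γ_{K_λ}` acts trivially on `T^{(k)}`, so that the letter does not depend on the inner ambiguity of `δ_λ`.
Inputs discharged inside and remaining binders: as in `stub_le_ker_locR_insert_of_stub_le_ker_locR` below
(`hφ := ConjugationDatum.φ_mem_localRingClassSubgroup` discharges `hφ` by name).
[cite: Howard2004HeegnerKolyvagin, Prop. 1.5.9 (arXiv:1202.6340 Prop. 2.5.9, p. 10 L146 – p. 11 L13) and Lemma 1.6.4 (p. 12 L10–21)] [cite: MilneADT2006, Ch. I Cor. 2.3 and Thm. 4.10] -/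
theorem engine_h159 (S : DVRSetting p K R N Rk Nbar Nq) (hy : S.SatisfiesH)
    (hdec : S.HasLevelDecompositions hy) (hd : NumberField.discr K < -4)
    (hPT : poitouTate_selmerStructure_duality K)
    (hI : ∀ v ∈ S.L, ∀ g ∈ absInertia (v.adicCompletion K), S.cd.φ v g ∈ absInertia ((S.cd.σ • v).adicCompletion K))
    (hφ : ∀ v ∈ S.L, ∀ h ∈ localRingClassSubgroup (residueChar v) S.jbar v,
      S.cd.φ v h ∈ localRingClassSubgroup (residueChar v) S.jbar (S.cd.σ • v))
    (hφI : ∀ (v : HeightOneSpectrum (𝓞 K)) (hv : S.cd.σ • v = v), v ∈ S.L →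
      ∀ g : absoluteGaloisGroup (v.adicCompletion K), ∃ i ∈ absInertia (v.adicCompletion K),
        (hv ▸ S.cd.φ v g : absoluteGaloisGroup (v.adicCompletion K)) = i * g)
    (hφΛ : ∀ (v : HeightOneSpectrum (𝓞 K)) (hv : S.cd.σ • v = v), v ∈ S.L →
      ∀ g : absoluteGaloisGroup (v.adicCompletion K), ∃ l ∈ localRingClassSubgroup (residueChar v) S.jbar v,
        (hv ▸ S.cd.φ v g : absoluteGaloisGroup (v.adicCompletion K)) = l * g⁻¹)
    (hδ : ∀ (k : ℕ) (v : HeightOneSpectrum (𝓞 K)), v ∈ S.enginePrimes k → ∀ u w : N k,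
      (S.D k).e u ((S.T.ρ k) (S.cd.δ v) w) = (S.D k).e w ((S.T.ρ k) (S.cd.δ v) u))
    (hpar : letI := fun k => galoisCohomology.moduleH1 (S.T.ρ k) (S.T.hlin k)
      ∀ (k : ℕ) (n : Finset (HeightOneSpectrum (𝓞 K))) (q : HeightOneSpectrum (𝓞 K)),
        ↑n ⊆ S.enginePrimes k → q ∈ S.enginePrimes k → q ∉ n →
        Module.finrank (R ⧸ R ∙ S.π) ↥(Submodule.torsionBy R ↥(S.selmerModuleAt hy k n) S.π) % 2 =
          Module.finrank (R ⧸ R ∙ S.π) ↥(Submodule.torsionBy R ↥(S.selmerModuleAt hy k (insert q n)) S.π) % 2) :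
    letI := fun k => galoisCohomology.moduleH1 (S.T.ρ k) (S.T.hlin k)
    letI := fun k (v : Place K) =>
      galoisCohomology.moduleH1 ((S.T.ρ k).toLocal v) ((S.T.hlin k).restrictField (Place.Completion v))
    ∀ (k : ℕ) (n : Finset (HeightOneSpectrum (𝓞 K))) (q : HeightOneSpectrum (𝓞 K)),
      ↑n ⊆ S.enginePrimes k → q ∈ S.enginePrimes k → q ∉ n →
      S.stub hy hdec k n ≤ LinearMap.ker ((S.locR k (Sum.inr q)).domRestrict (S.selmerModuleAt hy k n)) →
      S.stub hy hdec k (insert q n) ≤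
        LinearMap.ker ((S.locR k (Sum.inr q)).domRestrict (S.selmerModuleAt hy k (insert q n))) := by
  intro k n q hn hq hqn hstub
  letI instG : Module R (galoisCohomology (S.T.ρ k) 1) := galoisCohomology.moduleH1 (S.T.ρ k) (S.T.hlin k)
  letI instL : ∀ v : Place K, Module R (galoisCohomology ((S.T.ρ k).toLocal v) 1) := fun v =>
    galoisCohomology.moduleH1 ((S.T.ρ k).toLocal v) ((S.T.hlin k).restrictField (Place.Completion v))
  have hp : p.Prime := Fact.out
  haveI : Finite (N k) := S.finite_level hy k
  haveI : Finite (Rk k) := S.finite_coeffLevel hy k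
  haveI : Module.Free (Rk k) (N k) := (hy.h0 k).1
  haveI : Module.Finite (Rk k) (N k) := Module.finite_of_finrank_eq_succ (n := 1) (hy.h0 k).2
  haveI : NeZero (p ^ S.e k) := ⟨pow_ne_zero _ hp.ne_zero⟩
  have hqL : q ∈ S.L := hq.1
  have hqfix : S.cd.σ • q = q := S.sigma_smul_eq_self_of_mem_L hy hqL
  have hqlev : q ∈ S.levelPrimes k := S.enginePrimes_subset_levelPrimes hy k hq
  have hnqlev : (↑(insert q n) : Set (HeightOneSpectrum (𝓞 K))) ⊆ S.levelPrimes k := by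
    rw [Finset.coe_insert]
    exact Set.insert_subset hqlev (hn.trans (S.enginePrimes_subset_levelPrimes hy k))
  have hnq : (↑(insert q n) : Set (HeightOneSpectrum (𝓞 K))) ⊆ S.enginePrimes k := by
    rw [Finset.coe_insert]; exact Set.insert_subset hq hn
  have hdeg : ∀ v ∈ S.enginePrimes k, IsDegreeTwo v := fun v hv => ((Set.mem_iInter.1 hv.2.1) k).1
  have hek : 0 < S.e k := hy.e_zero.trans_le (hy.e_strictMono.monotone (Nat.zero_le k))
  -- `p^{e_k}` kills `R_k` and `T^{(k)}`; `(ℓ+1)` kills `T^{(k)}` at an engine prime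
  have hpe : ((p : ℕ) : R) ^ S.e k ∈ IsLocalRing.maximalIdeal R ^ S.e k :=
    S.natCast_pow_mem_maximalIdeal_pow_of_le hy le_rfl
  have hRk : ∀ r : Rk k, p ^ S.e k • r = 0 := S.natCast_pow_smul_levelRing_eq_zero hy k hpe
  have hNk : ∀ m : N k, p ^ S.e k • m = 0 := fun m => by
    rw [← Nat.cast_smul_eq_nsmul R, Nat.cast_pow]
    exact hy.killed k _ hpe m
  have hNk' : ∀ x : N k, ∃ m : ℕ, p ^ m • x = 0 := fun x => ⟨S.e k, hNk x⟩
  have hRp : IsPrimaryTorsion p (Rk k) := fun r => ⟨S.e k, hRk r⟩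
  have hodd : Odd (p ^ S.e k) := (hp.odd_of_ne_two hy.p_odd).pow
  have hℓT : ∀ v ∈ S.enginePrimes k, ∀ x : N k, (residueChar v + 1) • x = 0 := by
    intro v hv x
    obtain ⟨a, ha⟩ := Ideal.mem_span_singleton'.mp hv.2.2.1
    have hs : ((p : ℕ) : R) ^ (2 * S.e k - 1) ∈ IsLocalRing.maximalIdeal R ^ S.e k :=
      S.natCast_pow_mem_maximalIdeal_pow_of_le hy (by omega)
    rw [← Nat.cast_smul_eq_nsmul R, ← ha, mul_smul, hy.killed k _ hs x, smul_zero]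
  have hϖ : Irreducible S.π := (IsDiscreteValuationRing.irreducible_iff_uniformizer S.π).mpr hy.unif
  have h2 : IsUnit (2 : R) := S.isUnit_two_of_satisfiesH hy
  have hsoc : ∀ a b : Rk k, S.π • a = 0 → S.π • b = 0 → a ≠ 0 → ∃ c : R, b = c • a :=
    Literature.Algebra.Module.exists_smul_eq_of_uniformizer_smul_eq_zero hϖ (hy.algebraMap_surjective k)
  -- the trivialisation `exp = log⁻¹` of `μ_{p^{e_k}}`
  have hpK : (p : K) ≠ 0 := Nat.cast_ne_zero.mpr hp.ne_zero
  obtain ⟨log, hlogbij, hlogχ, -⟩ := exists_compatible_muLog K p hpK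
  let Lg : MuCarrier K (p ^ S.e k) ≃+ ZMod (p ^ S.e k) := AddEquiv.ofBijective (log (S.e k)) (hlogbij (S.e k))
  let exp : ZMod (p ^ S.e k) →+ MuCarrier K (p ^ S.e k) := Lg.symm
  have hexpb : Bijective exp := Lg.symm.bijective
  have hexp : ∀ (g : absoluteGaloisGroup K) (x : ZMod (p ^ S.e k)),
      exp (cyclotomicCharacterModPow K p (S.e k) g * x) = mu K (p ^ S.e k) g (exp x) := fun g x => by
    apply Lg.injective
    change Lg (Lg.symm _) = log (S.e k) (mu K _ g (Lg.symm x))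
    rw [AddEquiv.apply_symm_apply, hlogχ, show log (S.e k) (Lg.symm x) = Lg (Lg.symm x) from rfl,
      AddEquiv.apply_symm_apply]
  -- the Frobenius character of `R_k`, `Θ` bijective, `H²`-detection
  obtain ⟨lam, hbij⟩ := exists_addMonoidHom_zmod_bijective_mul_compr₂ (R := Rk k)
    (S.isPrincipal_maximalIdeal_levelRing hy k) hRk
  have hlam : ∀ (z : ℤ_[p]) (a : Rk k), lam (algebraMap ℤ_[p] (Rk k) z * a) = PadicInt.toZModPow (S.e k) z * lam a :=
    apply_algebraMap_mul_eq_toZModPow_mul hRk lam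
  have hfrob : Bijective fun c : Rk k => DualityDatum.lamMul lam c := hbij
  have hΘ : Bijective ((S.D k).toTateDual lam hlam exp hexp) :=
    (S.D k).toTateDual_bijective lam hlam exp hexp hexpb (bijective_comp_linearMap_of_free lam hbij)
  have hdet : ∀ (v : Place K) (z : galoisCohomology ((S.D k).twistOne.toLocal v) 2),
      (∀ b : Rk k, cohomologyMap ((S.D k).expLamLocalHom (DualityDatum.lamMul lam b)
        (DualityDatum.lamMul_semilinear lam hlam b) exp hexp v) 2 z = 0) → z = 0 := by
    intro v z hz
    rcases v with w | v
    · exact galoisCohomology_two_toLocal_inl_eq_zero_of_odd (S.D k).twistOne w hodd hRk z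
    · refine (S.D k).eq_zero_of_forall_cohomologyMap_expLam_eq_zero_of_finite exp hexp hRk hexpb v z ?_
      intro lam' hlam'
      obtain ⟨b, hb⟩ := hfrob.2 lam'
      subst hb
      exact hz b
  obtain ⟨inv, hperf, hPT0, -, hSC⟩ := hPT (p ^ S.e k)
  -- the scalar structures and the modified Selmer structures `F(m)`, `F_q(n)`, `F^q(n)`
  have hρ : (S.T.ρ k).IsScalarLinear (Rk k) := hy.scalarLinear k
  have hcR : (S.t k).cond.IsScalarStable (S.T.hlin k) := fun v r x hx => hy.cond_smul k v r ⟨x, hx, rfl⟩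
  have htrR : (transverseStructure p (S.T.ρ k) S.jbar).IsScalarStable (S.T.hlin k) :=
    isScalarStable_transverseStructure p (S.T.hlin k) S.jbar
  have hmodR : ∀ a b c : Finset (HeightOneSpectrum (𝓞 K)),
      ((S.t k).cond.modify (transverseStructure p (S.T.ρ k) S.jbar) a b c).IsScalarStable (S.T.hlin k) :=
    fun a b c => hcR.modify (S.T.hlin k) htrR a b c
  have hn_fix : ∀ v ∈ n, S.cd.σ • v = v := fun v hv => S.sigma_smul_eq_self_of_mem_L hy (hn hv).1
  have hnq_fix : ∀ v ∈ insert q n, S.cd.σ • v = v := fun v hv => S.sigma_smul_eq_self_of_mem_L hy (hnq hv).1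
  have hσmem : ∀ v ∈ insert q n, S.cd.σ • v ∈ insert q n := fun v hv => by rw [hnq_fix v hv]; exact hv
  have htrivAt : ∀ v ∈ insert q n, ∀ (g : absoluteGaloisGroup (v.adicCompletion K)) (x : N k),
      GaloisRep.toLocal v (S.T.ρ k) g x = x := fun v hv g x =>
    S.toLocal_apply_eq_self_of_subset_enginePrimes hy (k := k) (j := k) (by omega) hnq hv g x
  have htrivAt' : ∀ v ∈ insert q n, ∀ (g : absoluteGaloisGroup ((S.cd.σ • v).adicCompletion K)) (x : N k),
      GaloisRep.toLocal (S.cd.σ • v) (S.T.ρ k) g x = x := fun v hv g x =>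
    S.toLocal_apply_eq_self_of_subset_enginePrimes hy (k := k) (j := k) (by omega) hnq (hσmem v hv) g x
  have htrivTwAt : ∀ v ∈ insert q n, ∀ (g : absoluteGaloisGroup (v.adicCompletion K)) (x : N k),
      GaloisRep.toLocal v (S.cd.twist (S.T.ρ k)) g x = x := fun v hv =>
    S.cd.toLocal_twist_apply_eq_self (S.T.ρ k) v (htrivAt' v hv)
  have hS : ∀ v : HeightOneSpectrum (𝓞 K), (Sum.inr v : Place K) ∉ ((S.t k).modify S.jbar {q} ∅ n).Sigma →
      ((p ^ S.e k : ℕ) : 𝓞 K) ∉ v.asIdeal ∧ GaloisRep.IsUnramifiedAt v (S.T.ρ k) := fun v hv =>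
    S.not_mem_and_isUnramifiedAt_of_not_mem_Sigma k (S.e k) v (fun h => hv (Finset.mem_union_left _ h))
  have hqS : (Sum.inr q : Place K) ∈ ((S.t k).modify S.jbar {q} ∅ n).Sigma := by
    change _ ∈ (S.t k).Sigma ∪ _
    simp
  have h𝓡S : ((S.t k).cond.modify (transverseStructure p (S.T.ρ k) S.jbar) {q} ∅ n).IsUnramifiedOutside
      ((S.t k).modify S.jbar {q} ∅ n).Sigma :=
    ((S.t k).modify S.jbar {q} ∅ n).isHoward.isUnramifiedOutside
  -- H.4 for `F(n)`: `hy.h4` off `n`, the transverse self-orthogonality on `n`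
  have horth : (S.D k).IsSelfOrthogonal ((S.t k).cond.modify (transverseStructure p (S.T.ρ k) S.jbar) ∅ ∅ n) := by
    refine (S.D k).isSelfOrthogonal_of_eq_off (S.t k).cond _ (↑n : Set (HeightOneSpectrum (𝓞 K)))
      (fun v hv => ?_) (fun v hv => ?_) (hy.h4 k) (fun v hv => ?_)
    · rw [Finset.mem_coe] at hv ⊢
      rw [hn_fix v hv]; exact hv
    · rw [Finset.mem_coe] at hv
      exact SelmerStructure.modify_inr_of_not_mem _ _ (Finset.notMem_empty _) (Finset.notMem_empty _) hv
    · rw [Finset.mem_coe] at hv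
      have hv' : v ∈ insert q n := Finset.mem_insert_of_mem hv
      have hfix : S.cd.σ • v = v := hn_fix v hv
      have h𝓖v : (S.t k).cond.modify (transverseStructure p (S.T.ρ k) S.jbar) ∅ ∅ n (Sum.inr v) =
          transverseStructure p (S.T.ρ k) S.jbar (Sum.inr v) :=
        SelmerStructure.modify_inr_of_mem_transverse _ _ (Finset.notMem_empty _) (Finset.notMem_empty _) hv
      obtain ⟨σ₀, -, hcyc⟩ :=
        exists_forall_pow_inv_mul_mem_localRingClassSubgroup_of_isDegreeTwo hy.imagQuad hd S.jbar (hdeg v (hn hv))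
      refine (S.D k).isSelfOrthogonalAt_of_transverse lam hlam exp hexp hNk hΘ inv hperf (residueChar v) S.jbar v _
        (by rw [h𝓖v, transverseStructure_inr]; rfl) (by rw [hfix, h𝓖v, transverseStructure_inr]; rfl)
        (htrivAt v hv') (htrivAt' v hv') (htrivTwAt v hv') hNk' hodd hRk σ₀ hcyc (hφ v (hn hv).1) ?_
      rw [hfix, h𝓖v]
      exact natCard_transverseStructure_mul_eq_of_isDegreeTwo p hy.imagQuad hd (S.T.ρ k) S.jbar (hdeg v (hn hv)) rfl
        (htrivAt v hv') (htrivAt v hv') hNk' (hℓT v (hn hv))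
  have hstab : ∀ v : HeightOneSpectrum (𝓞 K), v ≠ q → ∀ b : Rk k,
      ∀ a ∈ (S.t k).cond.modify (transverseStructure p (S.T.ρ k) S.jbar) ∅ ∅ n (Sum.inr v),
      galoisCohomology.scalarMapH1 ((S.T.ρ k).toLocal (Sum.inr v)) (DualityDatum.isScalarLinear_toLocal hρ (Sum.inr v)) b a ∈
        (S.t k).cond.modify (transverseStructure p (S.T.ρ k) S.jbar) ∅ ∅ n (Sum.inr v) :=
    fun v _ b a ha => ((hy.isScalarStable_cond k).modify hρ (isScalarStable_transverseStructure p hρ S.jbar)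
      ∅ ∅ n) (Sum.inr v) b ha
  have hinf : ∀ (w : InfinitePlace K) (c : galoisCohomology (S.T.ρ k) 1),
      galoisCohomology.localization (S.T.ρ k) (Sum.inl w) 1 c = 0 := S.localization_inl_eq_zero_level hy k
  have h𝓕q : (S.t k).cond (Sum.inr q) = unramifiedSubgroup (GaloisRep.toLocal q (S.T.ρ k)) 1 :=
    (S.t k).cond_inr_eq_of_mem (by rw [hy.primes_eq k]; exact hqL)
  have h𝒯q : transverseStructure p (S.T.ρ k) S.jbar (Sum.inr q) =
      transverseCondition p (S.T.ρ k) (residueChar q) S.jbar q := by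
    rw [transverseStructure_inr]; rfl
  have hqq : q ∈ insert q n := Finset.mem_insert_self q n
  obtain ⟨σ₀, -, hcyc⟩ := S.exists_mem_absInertia_forall_pow_inv_mul_mem_localRingClassSubgroup_of_mem_L hy hd hqL
  -- `H¹(K_q, T^{(k)}) = H¹_f ⊕ H¹_tr` `R`-linearly, both `≅ (R/π^{e_k})²` (Prop. 1.1.9 at the level, x9-p1-w3)
  obtain ⟨SVf, SVtr, hSVf0, hSVtr, hc, hef, hetr⟩ :=
    S.exists_unramified_transverse_submodules_of_mem_levelPrimes hy hd hqlev
  have hSVf : SVf.toAddSubgroup = (S.t k).cond (Sum.inr q) := hSVf0.trans h𝓕q.symm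
  -- the global `R`-submodules: `H¹_{F(n)}`, `H¹_{F(nq)}`, `H¹_{F_q(n)}`, `loc_q H¹_{F^q(n)}`
  let S𝓢 : Submodule R (galoisCohomology (S.T.ρ k) 1) :=
    galoisCohomology.submoduleOfStable (S.T.hlin k)
      ((S.t k).cond.modify (transverseStructure p (S.T.ρ k) S.jbar) ∅ {q} n).selmerGroup
      (fun r _ hx => SelmerStructure.scalarMapH1_mem_selmerGroup (S.T.hlin k) (hmodR ∅ {q} n) r hx)
  let S𝓡 : Submodule R (galoisCohomology (S.T.ρ k) 1) :=
    galoisCohomology.submoduleOfStable (S.T.hlin k)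
      ((S.t k).cond.modify (transverseStructure p (S.T.ρ k) S.jbar) {q} ∅ n).selmerGroup
      (fun r _ hx => SelmerStructure.scalarMapH1_mem_selmerGroup (S.T.hlin k) (hmodR {q} ∅ n) r hx)
  let SA : Submodule R (galoisCohomology ((S.T.ρ k).toLocal (Sum.inr q)) 1) := S𝓡.map (S.locR k (Sum.inr q))
  have hSA : SA.toAddSubgroup =
      ((S.t k).cond.modify (transverseStructure p (S.T.ρ k) S.jbar) {q} ∅ n).selmerGroup.map
        (galoisCohomology.localization (S.T.ρ k) (Sum.inr q) 1) := by
    ext x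
    simp only [SA, S𝓡, Submodule.mem_toAddSubgroup, Submodule.mem_map, AddSubgroup.mem_map,
      galoisCohomology.mem_submoduleOfStable_iff, locR_apply]
  have hS₁ : (S.selmerModuleAt hy k n).toAddSubgroup =
      ((S.t k).cond.modify (transverseStructure p (S.T.ρ k) S.jbar) ∅ ∅ n).selmerGroup := rfl
  have hS₂ : (S.selmerModuleAt hy k (insert q n)).toAddSubgroup =
      ((S.t k).cond.modify (transverseStructure p (S.T.ρ k) S.jbar) ∅ ∅ (insert q n)).selmerGroup := rfl
  have hS𝓢 : S𝓢.toAddSubgroup =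
      ((S.t k).cond.modify (transverseStructure p (S.T.ρ k) S.jbar) ∅ {q} n).selmerGroup := rfl
  have hf : ∀ c, S.locR k (Sum.inr q) c = galoisCohomology.localization (S.T.ρ k) (Sum.inr q) 1 c := fun _ => rfl
  -- the two structure decompositions, same `ε` (Prop. 1.5.5), `λ = stubLength`
  obtain ⟨ε₁, hε₁, M₁, _, _, _, ⟨θ₁⟩, -, hlam₁⟩ := S.exists_linearEquiv_decomposition hy hdec k n hn
  obtain ⟨ε₂, hε₂, M₂, _, _, _, ⟨θ₂⟩, -, hlam₂⟩ := S.exists_linearEquiv_decomposition hy hdec k (insert q n) hnq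
  obtain rfl : ε₁ = ε₂ :=
    S.epsilon_eq_of_linearEquiv_decompositions hy k n q hn hq hqn hε₁ hε₂ ⟨θ₁⟩ ⟨θ₂⟩ (hpar k n q hn hq hqn)
  have hM₁ : Module.length R M₁ = (S.stubLength hy hdec k n : ℕ∞) := by
    rw [hlam₁, ENat.coe_toNat moduleLength_ne_top_of_finite]
  have hM₂ : Module.length R M₂ = (S.stubLength hy hdec k (insert q n) : ℕ∞) := by
    rw [hlam₂, ENat.coe_toNat moduleLength_ne_top_of_finite]
  haveI : Finite (R ⧸ IsLocalRing.maximalIdeal R ^ S.e k) := by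
    haveI : Finite (IsLocalRing.ResidueField R) := hy.coeffRing.finite_residueField
    exact CompleteLocalRing.finite_quotient_maximalIdeal_pow (R := R) (S.e k)
  have hQ : Module.length R (R ⧸ IsLocalRing.maximalIdeal R ^ S.e k) =
      ((Module.length R (R ⧸ IsLocalRing.maximalIdeal R ^ S.e k)).toNat : ℕ∞) :=
    (ENat.coe_toNat moduleLength_ne_top_of_finite).symm
  -- Prop. 1.5.9 at `q` (Frobenius form), instantiated
  have key := (S.D k).smul_le_ker_of_smul_le_ker_of_inert_local_frob lam hlam exp hexp hϖ h2 hsoc (S.T.hlin k) hρ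
    hNk hRp inv hPT0 hSC hperf hΘ hfrob hdet ((S.t k).modify S.jbar {q} ∅ n).Sigma hS (S.t k).cond
    (transverseStructure p (S.T.ρ k) S.jbar) n hqfix hqn hqS h𝓡S (fun v _ => horth v) hstab hinf
    (residueChar q) S.jbar h𝓕q h𝒯q (htrivAt q hqq) (htrivAt' q hqq) (htrivTwAt q hqq) hNk' hodd hRk (hI q hqL)
    (hφ q hqL) σ₀ hcyc (hφI q hqfix hqL) (hφΛ q hqfix hqL) (hδ k q hq) (S.locR k (Sum.inr q))
    (S.selmerModuleAt hy k n) (S.selmerModuleAt hy k (insert q n)) S𝓢 SA SVf SVtr hf hS₁ hS₂ hS𝓢 hSA hSVf hSVtr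
    hc hef hetr ε₁ _ (S.stubLength hy hdec k n) (S.stubLength hy hdec k (insert q n)) ⟨θ₁⟩ ⟨θ₂⟩ hQ hM₁ hM₂
  rw [show S.stub hy hdec k n = Ideal.span {S.π ^ S.stubLength hy hdec k n} • ⊤ from rfl,
    ideal_span_singleton_smul_top_le_ker_domRestrict_iff] at hstub
  rw [show S.stub hy hdec k (insert q n) = Ideal.span {S.π ^ S.stubLength hy hdec k (insert q n)} • ⊤ from rfl,
    ideal_span_singleton_smul_top_le_ker_domRestrict_iff]
  exact key hstub

/-- **The ENGINE binder `h159` on a `DVRSetting` — Howard's Prop. 1.5.9 «`loc_λ(Stub^{(k)}(n)) = 0 ⟹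
loc_λ(Stub^{(k)}(nλ)) = 0`» in the currency of `StubLemmaInductionProofs.mem_stub_of_stubLemmaInduction_levels'`**
(`P k = S.enginePrimes k`, `H k n = H¹_{F(n)}(K, T^{(k)}) = ↥(S.selmerModuleAt hy k n)`, `loc = S.locR` restricted,
`Stub = S.stub hy hdec`), at every level `k`, every `n ∈ 𝓝(𝓛^{(2k-1)})` and every `λ ∈ 𝓛^{(2k-1)} ∖ n`.
Inputs discharged inside: the Frobenius readout of the level ring `R_k` and `Θ`, `H²`-detection, the Poitou–Tate
family at `p^{e_k}` (from `hPT`), Prop. 1.1.9 and the counts at `λ` (`d_K < -4`), H.4 and scalar stability of `F(n)`,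
the trivial local actions, the vanishing at the infinite places, the two structure decompositions of `hdec` with
`λ = stubLength` and Prop. 1.5.5 (the same `ε` at `n` and `nλ`, modulo `hpar`).  Remaining binders (level-uniform):
`hpar` («`ρ(n) mod 2` independent of `n`», Lemma 1.5.3) and the conjugation-datum letters `hI hφ hφI hφΛ hδ` at the
primes of `𝓛`.
[cite: Howard2004HeegnerKolyvagin, Prop. 1.5.9 (arXiv:1202.6340 Prop. 2.5.9, p. 10 L146 – p. 11 L13) and Lemma 1.6.4 (p. 12 L10–21)] [cite: MilneADT2006, Ch. I Cor. 2.3 and Thm. 4.10] -/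
theorem stub_le_ker_locR_insert_of_stub_le_ker_locR (S : DVRSetting p K R N Rk Nbar Nq) (hy : S.SatisfiesH)
    (hdec : S.HasLevelDecompositions hy) (hd : NumberField.discr K < -4)
    (hPT : poitouTate_selmerStructure_duality K)
    -- the conjugation-datum letters at the primes of `𝓛`
    (hI : ∀ v ∈ S.L, ∀ g ∈ absInertia (v.adicCompletion K), S.cd.φ v g ∈ absInertia ((S.cd.σ • v).adicCompletion K))
    (hφ : ∀ v ∈ S.L, ∀ h ∈ localRingClassSubgroup (residueChar v) S.jbar v,
      S.cd.φ v h ∈ localRingClassSubgroup (residueChar v) S.jbar (S.cd.σ • v))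
    (hφI : ∀ (v : HeightOneSpectrum (𝓞 K)) (hv : S.cd.σ • v = v), v ∈ S.L →
      ∀ g : absoluteGaloisGroup (v.adicCompletion K), ∃ i ∈ absInertia (v.adicCompletion K),
        (hv ▸ S.cd.φ v g : absoluteGaloisGroup (v.adicCompletion K)) = i * g)
    (hφΛ : ∀ (v : HeightOneSpectrum (𝓞 K)) (hv : S.cd.σ • v = v), v ∈ S.L →
      ∀ g : absoluteGaloisGroup (v.adicCompletion K), ∃ l ∈ localRingClassSubgroup (residueChar v) S.jbar v,
        (hv ▸ S.cd.φ v g : absoluteGaloisGroup (v.adicCompletion K)) = l * g⁻¹)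
    (hδ : ∀ v ∈ S.L, ∀ (k : ℕ) (u w : N k),
      (S.D k).e u ((S.T.ρ k) (S.cd.δ v) w) = (S.D k).e w ((S.T.ρ k) (S.cd.δ v) u))
    -- Lemma 1.5.3 ⇒ «`ρ(n) mod 2` is independent of `n`» (the residual input of Prop. 1.5.5), torsion currency
    (hpar : letI := fun k => galoisCohomology.moduleH1 (S.T.ρ k) (S.T.hlin k)
      ∀ (k : ℕ) (n : Finset (HeightOneSpectrum (𝓞 K))) (q : HeightOneSpectrum (𝓞 K)),
        ↑n ⊆ S.enginePrimes k → q ∈ S.enginePrimes k → q ∉ n →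
        Module.finrank (R ⧸ R ∙ S.π) ↥(Submodule.torsionBy R ↥(S.selmerModuleAt hy k n) S.π) % 2 =
          Module.finrank (R ⧸ R ∙ S.π) ↥(Submodule.torsionBy R ↥(S.selmerModuleAt hy k (insert q n)) S.π) % 2) :
    letI := fun k => galoisCohomology.moduleH1 (S.T.ρ k) (S.T.hlin k)
    letI := fun k (v : Place K) =>
      galoisCohomology.moduleH1 ((S.T.ρ k).toLocal v) ((S.T.hlin k).restrictField (Place.Completion v))
    ∀ (k : ℕ) (n : Finset (HeightOneSpectrum (𝓞 K))) (q : HeightOneSpectrum (𝓞 K)),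
      ↑n ⊆ S.enginePrimes k → q ∈ S.enginePrimes k → q ∉ n →
      S.stub hy hdec k n ≤ LinearMap.ker ((S.locR k (Sum.inr q)).domRestrict (S.selmerModuleAt hy k n)) →
      S.stub hy hdec k (insert q n) ≤
        LinearMap.ker ((S.locR k (Sum.inr q)).domRestrict (S.selmerModuleAt hy k (insert q n))) :=
  S.engine_h159 hy hdec hd hPT hI hφ hφI hφΛ (fun k v hv u w => hδ v hv.1 k u w) hpar

end DVRSetting

end Literature.NumberTheory.GaloisCohomology.Howard2004

end
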